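import Summits.ValiantsHypothesis.ValiantsHypothesis.Theorems.ZeroOneTransfer.Negative.FalseOfTriangularDimersHard
import Summits.ValiantsHypothesis.ValiantsHypothesis.Theorems.DivisionGapZeroOneTransferStubKasteleynDetSq
import Summits.ValiantsHypothesis.ValiantsHypothesis.Theorems.DivisionGapZeroOneTransferStubPickParity
import Summits.ValiantsHypothesis.ValiantsHypothesis.Theorems.DivisionGapZeroOneTransferStubRhombusKasteleyn
import Summits.ValiantsHypothesis.ValiantsHypothesis.Theorems.DivisionGapZeroOneTransferStubSqrtCheap
import Summits.ValiantsHypothesis.ValiantsHypothesis.Theorems.DivisionGapZeroOneTransferStubDimerFamilyVP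
import HarnessLib

/-!
# Valiant's rhombus dimers are in `VP_ℂ` (Kasteleyn); the kill path of crux `ZeroOneTransfer` made unconditional

Part B of line `charged-uncharged` of crux `ZeroOneTransfer` (stmt-ValiantsHypothesis-5066, route
DivisionGap), composed from its five registered stubs, all landed:
`stub_kasteleynDetSq` (Kasteleyn's determinant identity `det K = (Σ_M Π η)²` under the combinatorial
Kasteleyn property), `stub_pickParity` (Pick's theorem mod 4 on the triangular lattice),
`stub_rhombusKasteleyn` (the rhombus `R_n` carries a Kasteleyn sign function), `stub_sqrtCheap`
(`VP` is closed under square roots at a unit base point), `stub_dimerFamilyVP` (glue).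

* `isVPFamily_triangularDimers` — **the complexified perfect-matching family `D_n` of the `n × n`
  rhombus of the triangular lattice is in `VP_ℂ`** (Valiant 1980, Thm 2, via Kasteleyn 1961 /
  FKT; here Pfaffian-free: `D_n² = det K_n`, `D_n = √(det K_n)`).  This is the hypothesis `hVP` of
  `ZeroOneTransfer.Negative.zeroOneTransfer_false_of_triangularDimers_hard`, discharged.
* `not_zeroOneTransfer_of_not_triangularDimersDivisionEasy` — **the route's kill criterion,
  unconditionally**: `¬ TriangularDimersDivisionEasy → ¬ ZeroOneTransfer` (crux 4 false ⇒ crux 3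
  false).
* `triangularDimersDivisionEasy_of_zeroOneTransfer` — the instance direction
  `ZeroOneTransfer → TriangularDimersDivisionEasy` (crux 4 IS the `D_n`-instance of crux 3), so that
  `ZeroOneTransfer ↔ TriangularDimersDivisionEasy ∧ DimerLift` with the route's `DimerLift`.
[cite: Valiant1980, §3 Thm. 2] [cite: Kasteleyn1961] [cite: FominGrigorievKoshevoy2014, Remark 1.5]
-/

namespace Summit.ValiantsHypothesis.ValiantsHypothesis.Theorems.DivisionGapZeroOneTransfer

-- the single-problem summit's namespace `Summit.ValiantsHypothesis.ValiantsHypothesis` repeats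
set_option linter.dupNamespace false

open MvPolynomial Literature.Computability.AlgebraicComplexity
open scoped NNReal
open Summit.ValiantsHypothesis.ValiantsHypothesis.Theses.DivisionGap
  (ZeroOneTransfer TriangularDimersDivisionEasy DimerLift)

/-- **`D_n ∈ VP_ℂ`** (Valiant 1980 Thm 2 / Kasteleyn): the complexification of the triangular-rhombus
perfect-matching family of crux `TriangularDimersDivisionEasy` is a `VP` family over `ℂ` — the five
stubs of Part B composed (registered sub-goal `triangularDimers_isVPFamily` of
stmt-ValiantsHypothesis-5066). [cite: Valiant1980, §3 Thm. 2] [cite: Kasteleyn1961] -/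
theorem isVPFamily_triangularDimers : Literature.Computability.AlgebraicComplexity.IsVPFamily fun n => MvPolynomial.map (Complex.ofRealHom.comp NNReal.toRealHom) (∑ f ∈ (Finset.univ : Finset (Fin n × Fin n → Fin n × Fin n)).filter (fun f => ∀ v, f (f v) = v ∧ f v ≠ v ∧ (((v.1 : ℕ) + 1 = (f v).1 ∧ (v.2 : ℕ) = (f v).2) ∨ (((f v).1 : ℕ) + 1 = v.1 ∧ (v.2 : ℕ) = (f v).2) ∨ ((v.1 : ℕ) = (f v).1 ∧ (v.2 : ℕ) + 1 = (f v).2) ∨ ((v.1 : ℕ) = (f v).1 ∧ ((f v).2 : ℕ) + 1 = v.2) ∨ ((v.1 : ℕ) + 1 = (f v).1 ∧ ((f v).2 : ℕ) + 1 = v.2) ∨ (((f v).1 : ℕ) + 1 = v.1 ∧ (v.2 : ℕ) + 1 = (f v).2))), ∏ v : Fin n × Fin n, (MvPolynomial.X (v, f v) : MvPolynomial ((Fin n × Fin n) × (Fin n × Fin n)) NNReal)) :=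
  stub_dimerFamilyVP stub_kasteleynDetSq (stub_rhombusKasteleyn stub_pickParity) stub_sqrtCheap

/-- **Kill criterion of the route, unconditionally** (registered sub-goal
`not_zeroOneTransfer_of_not_triangularDimersDivisionEasy` of stmt-ValiantsHypothesis-5066): if
Valiant's planar non-bipartite matching family is division-HARD (crux `TriangularDimersDivisionEasy`
false) then the transfer crux `ZeroOneTransfer` is false — the tree's
`zeroOneTransfer_false_of_triangularDimers_hard` with its Kasteleyn hypothesis discharged by
`isVPFamily_triangularDimers`. [cite: FominGrigorievKoshevoy2014, Remark 1.5] -/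
theorem not_zeroOneTransfer_of_not_triangularDimersDivisionEasy : ¬ Summit.ValiantsHypothesis.ValiantsHypothesis.Theses.DivisionGap.TriangularDimersDivisionEasy → ¬ Summit.ValiantsHypothesis.ValiantsHypothesis.Theses.DivisionGap.ZeroOneTransfer :=
  Summit.ValiantsHypothesis.ValiantsHypothesis.Theorems.ZeroOneTransfer.Negative.zeroOneTransfer_false_of_triangularDimers_hard
    isVPFamily_triangularDimers

/-- **Crux 4 is the `D_n`-instance of crux 3**: `ZeroOneTransfer → TriangularDimersDivisionEasy`
(the dimer family has 0/1 coefficients, `coeff_sum_prod_X_graph`, and is in `VP_ℂ`,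
`isVPFamily_triangularDimers`; the transfer's conclusion for it is crux 4 verbatim).
[cite: FominGrigorievKoshevoy2014, Remark 1.5] -/
theorem triangularDimersDivisionEasy_of_zeroOneTransfer :
    ZeroOneTransfer → TriangularDimersDivisionEasy := by
  intro H
  classical
  exact H (fun n => (Fin n × Fin n) × (Fin n × Fin n)) _
    (fun n m => by
      convert Summit.ValiantsHypothesis.ValiantsHypothesis.Theorems.ZeroOneTransfer.Negative.coeff_sum_prod_X_graph ℝ≥0 _ m)
    isVPFamily_triangularDimers

/-- **`ZeroOneTransfer ↔ TriangularDimersDivisionEasy ∧ DimerLift`**: the route's conjunction split of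
crux 3 into its decisive instance (crux 4) and the lift, now an honest equivalence (both directions
proved). [cite: FominGrigorievKoshevoy2014, Remark 1.5] -/
theorem zeroOneTransfer_iff_triangularDimers_and_dimerLift :
    ZeroOneTransfer ↔ TriangularDimersDivisionEasy ∧ DimerLift :=
  ⟨fun H => ⟨triangularDimersDivisionEasy_of_zeroOneTransfer H, fun _ => H⟩, fun h => h.2 h.1⟩

end Summit.ValiantsHypothesis.ValiantsHypothesis.Theorems.DivisionGapZeroOneTransfer
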